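import Literature.AlgebraicGeometry.Motives.GroupObjectSumMaps
import Literature.AlgebraicGeometry.AbelianSchemes.AbelianSchemeFibreEndomorphisms
import HarnessLib

/-!
# Sum maps into an abelian scheme: base change and generation of the fibres

Topic `Literature/AlgebraicGeometry/AbelianSchemes`; the `AbelianScheme`-currency reading of
`Motives/GroupObjectSumMaps` (III-0 road of the `hodgecm-mathlib` cell, SPEC §F1/§F5).  THEOREMS ONLY (no
definition, no named fact, D-0026 debt 0).

For an abelian scheme `𝒜` over `Spec R`, an `R`-morphism `Ψ : Y ⟶ 𝒜.X` and a ring map `f : R → R′` (resp. a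
field-valued point `φ : R → κ`), the base change `𝒜_{R′} = AbelianScheme.baseChange f 𝒜` (resp. the fibre
`𝒜_φ = 𝒜.fibre φ`, an abelian variety over `κ`) carries BY CONSTRUCTION the group law `Functor.grpObjObj` of
`Over.pullback (Spec f)`, so the generic sum maps `pmSumGrp` of `f^*Ψ` into `𝒜_{R′}` ARE those of
`GroupObjectSumMaps` §3 (`pmSumGrp_baseChange_eq`, `rfl`), and:

* `pullback_map_pmSumGrp_baseChange` — `f^*(s_n(Ψ)) = e_n ≫ s_n(f^*Ψ)` read on `𝒜_{R′}`;
* `surjective_pmSumGrp_baseChange_iff` — `s_n(f^*Ψ)` (into `𝒜_{R′}`) is surjective iff `f^*(s_n(Ψ))` is;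
* **`generates_fibre_iff`** — at a field-valued point, `Ψ_φ : Y_φ → 𝒜_φ` GENERATES the abelian variety `𝒜_φ`
  (Lang II §3: some Serre sum map is surjective) iff some relative sum map `s_n(Ψ)` base-changes to a surjection
  along `Spec κ → Spec R`; `generates_fibre_of_surjective_pmSumGrp` — in particular if some `s_n(Ψ)` is itself
  surjective (surjectivity is stable under base change, Görtz–Wedhorn I Prop. 4.32 (2)).

This is the step «`Generates Ψ_L` from (S3)+(S4): `pmSum Ψ_L n₀ = (pmSumGrp Ψ n₀)_L` is surjective» of the road
memo, packaged so that the assembly never unfolds a group law.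

## References

* [Serre1958MorphismesUniversels] J.-P. Serre, *Morphismes universels et variété d'Albanese*, Sém. Chevalley 4
  (1958/59), exp. 10, no. 1 (Déf. 1).
* [Lang1983AbelianVarieties] S. Lang, *Abelian Varieties* (1959/1983), II §3 (p. 35).
* [GortzWedhorn2020] U. Görtz, T. Wedhorn, *Algebraic Geometry I*, 2nd ed. (2020), Section (4.7), Prop. 4.32 (2),
  Remark 16.54.
* [MumfordFogartyKirwan1994] D. Mumford, J. Fogarty, F. Kirwan, *Geometric Invariant Theory*, 3rd ed., Ch. 6 §1
  Def. 6.1 (p. 115) (abelian schemes).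
-/

noncomputable section

universe u

open CategoryTheory CategoryTheory.Limits AlgebraicGeometry MonoidalCategory CartesianMonoidalCategory

namespace Literature.AlgebraicGeometry.AbelianSchemes.AbelianScheme

open Literature.AlgebraicGeometry.Motives
open scoped MonObj Obj

variable {R : Type u} [CommRing R] (𝒜 : AbelianScheme R) {Y : SchemeOver R} (Ψ : Y ⟶ 𝒜.X)

section BaseChange

variable {R' : Type u} [CommRing R'] (f : R →+* R')

/-- The sum maps of `f^*Ψ` into the base-changed abelian scheme `𝒜_{R′}` (with ITS group law) are the generic
sum maps of `GroupObjectSumMaps` for the transported group law `Functor.grpObjObj` — by `rfl`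
(`AbelianScheme.baseChange_grpObj`). [cite: GortzWedhorn2020, Remark 16.54] -/
theorem pmSumGrp_baseChange_eq (n : ℕ) :
    pmSumGrp (G := (𝒜.baseChange f).X) ((Over.pullback (specMap f)).map Ψ) n =
      @pmSumGrp _ _ _ _ _ (Functor.grpObjObj (F := Over.pullback (specMap f)))
        ((Over.pullback (specMap f)).map Ψ) n :=
  rfl

/-- **Base change of the sum maps into an abelian scheme**: `f^*(s_n(Ψ)) = e_n ≫ s_n(f^*Ψ)`, the right-hand
sum map taken in `𝒜_{R′} = AbelianScheme.baseChange f 𝒜`, `e_n` the monoidal structure isomorphism of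
`Over.pullback (Spec f)`. [cite: Serre1958MorphismesUniversels, no. 1] [cite: GortzWedhorn2020, Remark 16.54] -/
theorem pullback_map_pmSumGrp_baseChange (n : ℕ) :
    (Over.pullback (specMap f)).map (pmSumGrp Ψ n) =
      (pmPowObjIso (Over.pullback (specMap f)) Y n).hom ≫
        pmSumGrp (G := (𝒜.baseChange f).X) ((Over.pullback (specMap f)).map Ψ) n :=
  pullback_map_pmSumGrp (specMap f) Ψ n

/-- `s_n(f^*Ψ)` into `𝒜_{R′}` is surjective iff the base change `f^*(s_n(Ψ))` is.
[cite: GortzWedhorn2020, Prop. 4.32 (2)] -/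
theorem surjective_pmSumGrp_baseChange_iff (n : ℕ) :
    Surjective (pmSumGrp (G := (𝒜.baseChange f).X) ((Over.pullback (specMap f)).map Ψ) n).left ↔
      Surjective ((Over.pullback (specMap f)).map (pmSumGrp Ψ n)).left :=
  surjective_pullback_map_pmSumGrp_left_iff (specMap f) Ψ n

/-- `s_n(f^*Ψ)` into `𝒜_{R′}` is surjective if `s_n(Ψ)` is. [cite: GortzWedhorn2020, Prop. 4.32 (2)] -/
theorem surjective_pmSumGrp_baseChange (n : ℕ) [Surjective (pmSumGrp Ψ n).left] :
    Surjective (pmSumGrp (G := (𝒜.baseChange f).X) ((Over.pullback (specMap f)).map Ψ) n).left :=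
  surjective_pmSumGrp_pullback_left (specMap f) Ψ n

end BaseChange

section Fibre

variable {κ : Type u} [Field κ] (φ : R →+* κ)

/-- **`Ψ_φ` generates the fibre `𝒜_φ` iff some relative sum map base-changes to a surjection**: for a
field-valued point `φ : R → κ`, `Generates (Ψ_φ : Y_φ → 𝒜_φ)` (Lang II §3 / Serre Déf. 1, the tree's `Generates`
for the abelian variety `𝒜.fibre φ`) `↔ ∃ n, f^*(s_n(Ψ))` surjective, `f = Spec φ`.
[cite: Lang1983AbelianVarieties, II §3 (p. 35)] [cite: Serre1958MorphismesUniversels, no. 1 Déf. 1] -/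
theorem generates_fibre_iff :
    Generates (A := 𝒜.fibre φ) ((Over.pullback (specMap φ)).map Ψ) ↔
      ∃ n, Surjective ((Over.pullback (specMap φ)).map (pmSumGrp Ψ n)).left := by
  rw [generates_iff_exists_surjective_pmSumGrp]
  exact exists_congr fun n => surjective_pullback_map_pmSumGrp_left_iff (specMap φ) Ψ n

/-- **`Ψ_φ` generates the fibre `𝒜_φ` as soon as ONE relative sum map `s_n(Ψ)` is surjective** (over the whole
base; surjectivity descends to the fibre by base change). [cite: Lang1983AbelianVarieties, II §3 (p. 35)]
[cite: GortzWedhorn2020, Prop. 4.32 (2)] -/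
theorem generates_fibre_of_surjective_pmSumGrp (n : ℕ) [Surjective (pmSumGrp Ψ n).left] :
    Generates (A := 𝒜.fibre φ) ((Over.pullback (specMap φ)).map Ψ) :=
  (generates_iff_exists_surjective_pmSumGrp _).2 ⟨n, surjective_pmSumGrp_pullback_left (specMap φ) Ψ n⟩

/-- The same after an isomorphism of `κ`-schemes onto the source of `Ψ_φ` (the shape met when `Y_φ` is only
identified with a given `κ`-scheme up to a canonical isomorphism, e.g. `(X_T)_κ ≅ X_κ`).
[cite: Lang1983AbelianVarieties, II §3 (p. 35)] -/
theorem generates_iso_hom_comp_fibre_of_surjective_pmSumGrp {Z : SchemeOver κ}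
    (e : Z ≅ (Over.pullback (specMap φ)).obj Y) (n : ℕ) [Surjective (pmSumGrp Ψ n).left] :
    Generates (A := 𝒜.fibre φ) (e.hom ≫ (Over.pullback (specMap φ)).map Ψ) :=
  (generates_iso_hom_comp_iff _ e).2 (generates_fibre_of_surjective_pmSumGrp 𝒜 Ψ φ n)

end Fibre

end Literature.AlgebraicGeometry.AbelianSchemes.AbelianScheme

end
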